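import Summits.ResolutionOfSingularities.ResolutionOfSingularities.Theorems.EquisingularLiftEquisingularLiftNatCarrierDeltaComapFrame
import Literature.AlgebraicGeometry.Resolution.BlowupChartRegular
import Mathlib.RingTheory.Flat.TorsionFree
import Mathlib.RingTheory.Flat.Localization
import HarnessLib

/-!
# [OURS · L1 W4.5(b) · EL♮ kit K7] REGULAR SPECIAL FIBRE + FLAT ⇒ REGULAR, THROUGH THE MODEL SQUARE

Crux `EquisingularLiftNat` = stmt-ResolutionOfSingularities-20038 (route EquisingularLift), line `sections`; helper file
`--supports … --as helper` for the HSUB(ReachTC⁺)₃ assembly of res-L1-w45b-stub-1 (call-site row «regular special fibre +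
flat + ϖ ⇒ regular», used by `inv_step_regular` (v″) / `inv_final`). HONEST FRAMING: OURS (cell res-hironaka, slot W4.5(b));
NOT a statement of any manuscript; AI-written, weaker than expert review. No `sorry`; standard axioms.

CONTENT.
* `mem_nonZeroDivisors_Γgerm_appTop_of_flat` — over a domain `O`, along a FLAT `r : X → Spec O` the germ of `r^* ϖ` at any
  point is a NON-ZERO-DIVISOR for `ϖ ≠ 0` (flat modules over a domain are torsion-free; no integrality of `X` needed; the weaker
  `≠ 0` is res-L1-w45b-stub-1's `Γgerm_ne_zero_of_flat`, …NatGoodAtOfFlatModel p527131).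
* `isRegularLocalRing_of_model_of_flat` — in a model square `IsPullback j t r (Spec θ)` (`θ : O ↠ k`, `O` a DVR) with `r` flat
  and `X` locally Noetherian: `F` regular at `x` ⇒ `X` regular at `j x`. Indeed `j^♯_x : 𝒪_{X,jx} ↠ 𝒪_{F,x}` has kernel `(ϖ)`
  (res-D-pv-029 …NatCarrierDeltaComapFrame p520689: `stalkMap_model_surjective`, `stalkMap_model_varpi`,
  `ker_stalkMap_model_le`), `ϖ` is a non-zero-divisor in `𝔪_{jx}`, and regularity lifts modulo a regular element
  (`isRegularLocalRing_of_quotient_span_singleton`, Matsumura 14.2). The converse direction (X regular ⇒ F regular at x, given a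
  frame) is res-type-100's `isRegularLocalRing_stalk_of_model` (…NatCarrierDeltaModelFrame p524314). Apply it to the in-carrier
  surface `D = V(𝓢 ⊔ K)` with ITS model square (tree `isPullback_subschemeMap` pasted with the stage square, as in stub-1's
  `exists_inCarrier_section`) to get clause (v) at the new special points from the regularity of the downstairs curve.

References: H. Matsumura, *Commutative Ring Theory* (1986/87), Thm. 7.7 and §7 (flat ⇒ torsion-free), Thm. 14.2.
-/

set_option linter.dupNamespace false -- mandated namespace `Summit.<Summit>.<Problem>` of this single-conjunct summit
set_option linter.overlappingInstances false -- signatures carry `[IsDomain O] [IsDiscreteValuationRing O]`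

noncomputable section

open CategoryTheory CategoryTheory.Limits AlgebraicGeometry TopologicalSpace Topology
open Literature.AlgebraicGeometry.Resolution
open AlgebraicGeometry.Scheme.IdealSheafData
open Summit.ResolutionOfSingularities.ResolutionOfSingularities.Theses.EquisingularLift.Split
open Summit.ResolutionOfSingularities.ResolutionOfSingularities.Cruxes.EquisingularLift.StrataSplit

namespace Summit.ResolutionOfSingularities.ResolutionOfSingularities.Cruxes.EquisingularLiftNat.Sections

/-! ## Flatness keeps the uniformizer alive -/

/-- **Along a flat morphism to `Spec` of a domain, the germ of a non-zero constant is a non-zero-divisor.** For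
`r : X → Spec O` flat, `O` a domain and `ϖ ≠ 0`, the germ at any `x ∈ X` of the global section `r^* ϖ` is a non-zero-divisor
of `𝒪_{X,x}`: the stalk is flat over `O_{r x}`, hence over `O`, so torsion-free. [cite: Matsumura1987, Thm. 7.7 and §7] -/
theorem mem_nonZeroDivisors_Γgerm_appTop_of_flat {O : Type} [CommRing O] [IsDomain O] {X : Scheme.{0}}
    (r : X ⟶ Spec (.of O)) [Flat r] (x : X) {ϖ : O} (hϖ : ϖ ≠ 0) :
    (X.presheaf.Γgerm x).hom (r.appTop.hom ((Scheme.ΓSpecIso (.of O)).inv.hom ϖ)) ∈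
      nonZeroDivisors (X.presheaf.stalk x) := by
  set S := (Spec (.of O)).presheaf.stalk (r x)
  set T := X.presheaf.stalk x
  set φ := (r.stalkMap x).hom with hφ
  letI : Algebra O S := StructureSheaf.stalkAlgebra O (r x)
  haveI : IsLocalization.AtPrime S (r x).asIdeal := StructureSheaf.IsLocalization.to_stalk O (r x)
  have hflat : φ.Flat := Flat.stalkMap r x
  letI : Algebra S T := φ.toAlgebra
  haveI : Module.Flat S T := hflat
  letI : Algebra O T := (φ.comp (algebraMap O S)).toAlgebra
  haveI : IsScalarTower O S T := IsScalarTower.of_algebraMap_eq (fun _ => rfl)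
  haveI : Module.Flat O S := IsLocalization.flat S (r x).asIdeal.primeCompl
  haveI : Module.Flat O T := Module.Flat.trans O S T
  -- the germ is `algebraMap O T ϖ`
  have hgerm : (X.presheaf.Γgerm x).hom (r.appTop.hom ((Scheme.ΓSpecIso (.of O)).inv.hom ϖ)) = algebraMap O T ϖ := by
    rw [← stalkMap_Γgerm_apply' r x, ← algebraMap_stalk_eq_Γgerm O (r x) ϖ]
    rfl
  have hreg : IsSMulRegular T ϖ := Module.Flat.isSMulRegular_of_nonZeroDivisors (mem_nonZeroDivisors_of_ne_zero hϖ)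
  rw [hgerm, mem_nonZeroDivisors_iff]
  refine ⟨fun m hm => hreg ?_, fun m hm => hreg ?_⟩
  · show ϖ • m = ϖ • 0
    rw [smul_zero, Algebra.smul_def]; exact hm
  · show ϖ • m = ϖ • 0
    rw [smul_zero, Algebra.smul_def, mul_comm]; exact hm

/-! ## Regular special fibre and flatness give a regular total space -/

/-- **Regular special fibre + flat ⇒ regular, through the model square.** In a model square `IsPullback j t r (Spec θ)` over
a DVR with `r` flat and `X` locally Noetherian: if the special fibre `F` is regular at `x` then `X` is regular at `j x`.
Indeed `j^♯_x : 𝒪_{X,jx} ↠ 𝒪_{F,x}` has kernel `(ϖ)` (`ker_stalkMap_model_le`, `stalkMap_model_varpi`), `ϖ` is a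
non-zero-divisor in `𝔪_{jx}` by flatness, and regularity lifts modulo a regular element.
[cite: Matsumura1987, Thm. 14.2] -/
theorem isRegularLocalRing_of_model_of_flat (O : Type) [CommRing O] [IsDomain O] [IsDiscreteValuationRing O]
    (k : Type) [Field k] (θ : O →+* k) (hθ : Function.Surjective θ) {X F : Scheme.{0}} (r : X ⟶ Spec (.of O)) [Flat r]
    [IsLocallyNoetherian X] (j : F ⟶ X) (t : F ⟶ Spec (.of k))
    (hsq : IsPullback j t r (Spec.map (CommRingCat.ofHom θ))) (x : F) (hx : IsRegularLocalRing (F.presheaf.stalk x)) :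
    IsRegularLocalRing (X.presheaf.stalk (j x)) := by
  haveI := hx
  obtain ⟨ϖ, hϖ⟩ := IsDiscreteValuationRing.exists_irreducible O
  set S := X.presheaf.stalk (j x)
  set g : S := (X.presheaf.Γgerm (j x)).hom (r.appTop.hom ((Scheme.ΓSpecIso (.of O)).inv.hom ϖ)) with hg
  have hg0 : g ∈ nonZeroDivisors S := mem_nonZeroDivisors_Γgerm_appTop_of_flat r (j x) hϖ.ne_zero
  -- the stalk map `j^♯_x` is onto with kernel `(g)`
  have hsurj := stalkMap_model_surjective θ hθ r j t hsq x
  have hker : RingHom.ker (j.stalkMap x).hom = Ideal.span {g} := by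
    refine le_antisymm (ker_stalkMap_model_le O k θ hθ r j t hsq x ϖ hϖ) ?_
    rw [Ideal.span_le, Set.singleton_subset_iff, SetLike.mem_coe, RingHom.mem_ker]
    exact stalkMap_model_varpi θ hθ r j t hsq x ϖ (by rw [hϖ.maximalIdeal_eq]; exact Ideal.mem_span_singleton_self ϖ)
  -- `g` is not a unit: it dies in the non-zero ring `𝒪_{F,x}`
  have hg𝔪 : g ∈ IsLocalRing.maximalIdeal S := by
    rw [IsLocalRing.mem_maximalIdeal, mem_nonunits_iff]
    intro hu
    have h0 : (j.stalkMap x).hom g = 0 := by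
      rw [← RingHom.mem_ker, hker]; exact Ideal.mem_span_singleton_self g
    have h1 := hu.map (j.stalkMap x).hom
    rw [h0] at h1
    exact not_isUnit_zero h1
  -- `S/(g) ≅ 𝒪_{F,x}` is regular, hence so is `S`
  have e : S ⧸ Ideal.span {g} ≃+* F.presheaf.stalk x :=
    (Ideal.quotEquivOfEq hker.symm).trans (RingHom.quotientKerEquivOfSurjective hsurj)
  haveI : IsRegularLocalRing (S ⧸ Ideal.span {g}) := IsRegularLocalRing.of_ringEquiv e.symm
  exact isRegularLocalRing_of_quotient_span_singleton hg0 hg𝔪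

end Summit.ResolutionOfSingularities.ResolutionOfSingularities.Cruxes.EquisingularLiftNat.Sections

end
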